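import Literature.NumberTheory.EllipticCurves.Disegni2017.ChiLineRankinSelberg
import Literature.NumberTheory.GaloisRepresentations.HeckeCharacterLocalPadicModelProofs
import Literature.NumberTheory.GaloisRepresentations.DirichletHeckeCharacterConductorProofs
import HarnessLib

/-!
# Disegni 2017, Definition 4 discharged in the RAMIFIED branch: a ramified `χ_w` at a place of degree
# one is never exceptional (`Z_w = (χ_w(p)α)^{-n} · τ ≠ 0`, `τ` a primitive Gauss sum mod `p^n`)

Topic `Literature/NumberTheory/EllipticCurves`, cluster `Disegni2017`; PROOFS file (theorems only: no
definition, no named fact, no instance — D-0026 net debt 0). Companion of `ChiLineRankinSelberg.lean`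
(typer file of the BSD cell `bsd-print-cf2`, (U5a′): `localValueNat`, `localGaussSum`,
`interpolationFactorZw`, `IsNotExceptionalAt`, and the unfolding
`isNotExceptionalAt_iff_of_not_isUnramifiedAt` — «ramified ⇒ (not exceptional ⟺ the local Gauss sum at
the conductor is non-zero)»), which records the remaining obligation verbatim: "a Gauss sum of a
character of conductor exactly `p^n` IS non-zero (Lemma A.1.1) … the bridge … is the consumer's
discharge lemma". THIS FILE is that discharge:

* `localGaussSum_conductorExponentAt_ne_zero` — for ANY number field `K`, ANY Hecke character `χ`, and a
  place `w ∣ p` of DEGREE ONE (`e(w|p) = f(w|p) = 1`, `K_w = ℚ_p`) at which `χ` is RAMIFIED: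
  `localGaussSum p χ w (conductorExponentAt χ w) ≠ 0`. Proof: `χ_w|_{𝒪_wˣ}` transported to `ℤ_pˣ`
  (`HeckeCharacter.exists_mulChar_padicInt_model`) has conductor exactly `p^n`, `n = f(χ_w) ≥ 1`, so the
  sum over the representatives `0 < k < p^n`, `p ∤ k`, is the Gauss sum of a PRIMITIVE Dirichlet character
  mod `p^n` (`GaussSums.sum_range_mul_stdAddChar_ne_zero_of_conductor`,
  `HeckeCharacter.sum_localComponent_natCast_mul_stdAddChar_ne_zero_of_not_isUnramifiedAt'`), non-zero
  (Disegni Lemma A.1.1; Tate §2.5; Neukirch VII (2.6): `|τ|² = p^n`).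
* ★ `isNotExceptionalAt_of_not_isUnramifiedAt` — hence `IsNotExceptionalAt a χ w` for every unit-root
  datum `a ≠ 0`: Definition 4 holds for every RAMIFIED `χ_w` ("exceptional" characters occur only in the
  unramified branch, `α·χ_w(ϖ_w) = 1`, §1.4.1 PDF p. 9 L25–26).
* `…_of_split` — packaged for a quadratic `K` and a split `p` (`#{𝔮 ∣ p} = 2 ⇒ e = f = 1`).
* ★★ `isNotExceptionalAt_mul_compRelNorm_ofDirichlet_of_split` — the PAIR-CHARACTER shape of road (C) on
  the BSD crux `PrintCf2.SplitBadTwoRankOneOfFacts`: for `χ = χ₀ · (ψ_θ ∘ N_{K/ℚ})` with `χ₀` unramified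
  at `𝔮 ∣ p` and `θ` a PRIMITIVE Dirichlet character mod `m` with `p ∣ m` (road (C): `p = 2`,
  `K = ℚ(√−7)`, `θ = ε_{d*}` of conductor `4` or `8`, `χ₀` the anticyclotomic part), `χ` has conductor
  exponent `v_p(m) ≥ 1` at `𝔮` (`hasConductorExponentAt_mul_compRelNorm_ofDirichlet_of_split`, Neukirch
  VII (6.9)), hence is ramified, hence NOT EXCEPTIONAL at `𝔮` — uniformly in the three classes
  `d* ∈ {−1, ±2}`, as the cell's entry ticket §2 asserts. Nothing about BSD is proved here; the crux is
  NOT closed by this file (it is the (Δ2)-hypothesis discharge only).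

## References

* D. Disegni, *The p-adic Gross–Zagier formula on Shimura curves*, Compos. Math. 153 (2017) =
  arXiv:1510.02114v3: Theorem A (`Z_w`, `τ`; PDF p. 6 L54–59, p. 7 L1–6), Definition 4 = Def. 1.3.3
  (PDF p. 7 L50), §1.4.1 (PDF p. 9 L25–26), Lemma A.1.1 (PDF p. 70). [Disegni2017]
* J. Tate, *Fourier analysis in number fields and Hecke's zeta-functions* (1950/1967), §2.3, §2.5.
  [TateThesis1967]
* J. Neukirch, *Algebraic Number Theory* (1999), Ch. VII §2 Prop. (2.6), §6 Prop. (6.9)–(6.11).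
  [NeukirchANT1999]
-/

noncomputable section

open scoped NumberField
open NumberField IsDedekindDomain IsDedekindDomain.HeightOneSpectrum Rat.HeightOneSpectrum
  Literature.NumberTheory.GaloisRepresentations Literature.NumberTheory.Automorphic

namespace Literature.NumberTheory.EllipticCurves.Disegni2017

variable {p : ℕ} [hp : Fact p.Prime] {K : Type} [Field K] [NumberField K]

/-! ### §1 The local Gauss sum at the conductor of a ramified `χ_w` is non-zero -/

/-- The unit `natUnitAt w k hk ∈ K_wˣ` is the natural number `k` in `K_w`.
[cite: Disegni2017, Theorem A, τ(χ̃'_w, ψ_{E_w}) (arXiv v3 PDF p. 7 L2–6)] -/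
theorem coe_natUnitAt (w : HeightOneSpectrum (𝓞 K)) (k : ℕ) (hk : k ≠ 0) :
    ((natUnitAt w k hk : (w.adicCompletion K)ˣ) : w.adicCompletion K) = (k : w.adicCompletion K) := by
  change algebraMap K (w.adicCompletion K) ((Units.mk0 ((k : ℕ) : K) (Nat.cast_ne_zero.mpr hk) : Kˣ) : K) = _
  rw [Units.val_mk0, map_natCast]

omit hp in
/-- For `p ∤ k`, `localValueNat χ w k` is the local component `χ_w` at a unit `U ∈ K_wˣ` with `U = k`
(namely `natUnitAt w k`). [cite: Disegni2017, Theorem A, τ(χ̃'_w, ψ_{E_w}) (arXiv v3 PDF p. 7 L2–6)] -/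
theorem exists_unit_localValueNat_eq (χ : HeckeCharacter K) (w : HeightOneSpectrum (𝓞 K)) {k : ℕ}
    (hk : ¬ p ∣ k) :
    ∃ U : (w.adicCompletion K)ˣ, (U : w.adicCompletion K) = (k : w.adicCompletion K) ∧
      localValueNat χ w k = (χ.localComponent w U : ℂ) := by
  have hk0 : k ≠ 0 := by rintro rfl; exact hk (dvd_zero p)
  exact ⟨natUnitAt w k hk0, coe_natUnitAt w k hk0, by rw [localValueNat, dif_neg hk0]⟩

/-- `localGaussSum` as a sum over the representatives prime to `p` (the `p ∣ k` terms are `0` by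
definition). [cite: Disegni2017, Theorem A, τ(χ̃'_w, ψ_{E_w}) (arXiv v3 PDF p. 7 L2–6)] -/
theorem localGaussSum_eq_sum_filter (χ : HeckeCharacter K) (w : HeightOneSpectrum (𝓞 K)) (n : ℕ) :
    localGaussSum p χ w n =
      haveI : NeZero (p ^ n) := ⟨pow_ne_zero n hp.out.ne_zero⟩
      ∑ k ∈ (Finset.range (p ^ n)).filter (fun k => ¬ p ∣ k),
        localValueNat χ w k * ZMod.stdAddChar (N := p ^ n) (k : ZMod (p ^ n)) := by
  haveI : NeZero (p ^ n) := ⟨pow_ne_zero n hp.out.ne_zero⟩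
  rw [localGaussSum, Finset.sum_filter]
  refine Finset.sum_congr rfl fun k _ => ?_
  by_cases hk : p ∣ k
  · rw [if_pos hk, if_neg (not_not_intro hk), zero_mul]
  · rw [if_neg hk, if_pos hk]

/-- **The local Gauss sum of a RAMIFIED `χ_w` at its conductor is non-zero** (`w ∣ p` of degree one:
`p ∈ w`, `e(w|p) = f(w|p) = 1`). `localGaussSum p χ w n`, `n = f(χ_w) ≥ 1`, is the Gauss sum over the
representatives of `(𝒪_w/p^n)ˣ = (ℤ/p^n)ˣ` of the character `χ_w|_{𝒪_wˣ}`, which has conductor EXACTLY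
`p^n`; such a Gauss sum has absolute value `p^{n/2}` (Disegni Lemma A.1.1; Tate §2.5; Neukirch VII (2.6)).
[cite: Disegni2017, Lemma A.1.1 (arXiv v3 PDF p. 70) and Theorem A, Z_w (PDF p. 6 L58, p. 7 L1–6)]
[cite: TateThesis1967, §2.5] [cite: NeukirchANT1999, Ch. VII §2 Prop. (2.6)] -/
theorem localGaussSum_conductorExponentAt_ne_zero (χ : HeckeCharacter K) (w : HeightOneSpectrum (𝓞 K))
    (hw : ((p : ℕ) : 𝓞 K) ∈ w.asIdeal)
    (he : w.asIdeal.ramificationIdx (𝓞 ℚ) = 1) (hf : w.asIdeal.inertiaDeg (𝓞 ℚ) = 1)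
    (hram : ¬ χ.IsUnramifiedAt w) :
    localGaussSum p χ w (χ.conductorExponentAt w) ≠ 0 := by
  rw [localGaussSum_eq_sum_filter]
  exact HeckeCharacter.sum_localComponent_natCast_mul_stdAddChar_ne_zero_of_not_isUnramifiedAt' p χ w
    hw he hf hram (localValueNat χ w) fun k hk => exists_unit_localValueNat_eq χ w hk

/-! ### §2 Definition 4 for ramified characters -/

/-- ★ **A RAMIFIED `χ_w` is NOT EXCEPTIONAL** (Disegni 2017, Def. 4 / Def. 1.3.3), at a place `w ∣ p` of
degree one and for every unit-root datum `a ≠ 0`: `Z_w(χ_w) = (χ_w(p)·a)^{−n} · localGaussSum ≠ 0`.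
Exceptional characters live only in the unramified branch (`a·χ_w(ϖ_w) = 1`, §1.4.1).
[cite: Disegni2017, Def. 1.3.3 (arXiv v3 PDF p. 7 L50), §1.4.1 (PDF p. 9 L25–26), Lemma A.1.1 (PDF p. 70)] -/
theorem isNotExceptionalAt_of_not_isUnramifiedAt {a : ℂ} (ha : a ≠ 0) (χ : HeckeCharacter K)
    (w : HeightOneSpectrum (𝓞 K)) (hw : ((p : ℕ) : 𝓞 K) ∈ w.asIdeal)
    (he : w.asIdeal.ramificationIdx (𝓞 ℚ) = 1) (hf : w.asIdeal.inertiaDeg (𝓞 ℚ) = 1)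
    (hram : ¬ χ.IsUnramifiedAt w) :
    IsNotExceptionalAt (p := p) a χ w :=
  (isNotExceptionalAt_iff_of_not_isUnramifiedAt hram ha).mpr
    (localGaussSum_conductorExponentAt_ne_zero χ w hw he hf hram)

/-- **Ramified ⇒ not exceptional, at a split prime of a quadratic field** (`K/ℚ` Galois of degree `2`,
two primes above `p` — so `e = f = 1` at each —, `𝔮 ∋ p`, `χ` ramified at `𝔮`, `a ≠ 0`).
[cite: Disegni2017, Def. 1.3.3 (arXiv v3 PDF p. 7 L50), Lemma A.1.1 (PDF p. 70)] -/
theorem isNotExceptionalAt_of_not_isUnramifiedAt_of_split [IsGalois ℚ K]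
    (h2 : Module.finrank ℚ K = 2) (hsplit : ((Ideal.span {(p : ℤ)}).primesOver (𝓞 K)).ncard = 2)
    {a : ℂ} (ha : a ≠ 0) (χ : HeckeCharacter K) (𝔮 : HeightOneSpectrum (𝓞 K))
    (h𝔮 : ((p : ℕ) : 𝓞 K) ∈ 𝔮.asIdeal) (hram : ¬ χ.IsUnramifiedAt 𝔮) :
    IsNotExceptionalAt (p := p) a χ 𝔮 := by
  obtain ⟨he, hf⟩ :=
    ramificationIdx_eq_one_and_inertiaDeg_eq_one_of_ncard_primesOver_eq_two K p h2 hsplit 𝔮 h𝔮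
  exact isNotExceptionalAt_of_not_isUnramifiedAt ha χ 𝔮 h𝔮 he hf hram

/-! ### §3 The pair character `χ₀ · (ψ_θ ∘ N_{K/ℚ})` of road (C) is not exceptional above `p ∣ cond θ` -/

/-- **`χ₀ · (ψ_θ ∘ N_{K/ℚ})` is RAMIFIED at `𝔮 ∣ p`** when `χ₀` is unramified at `𝔮`, `θ` is primitive
mod `m` with `p ∣ m`, and `p` splits in the quadratic field `K`: its conductor exponent at `𝔮` is
`v_p(m) ≥ 1` (`hasConductorExponentAt_mul_compRelNorm_ofDirichlet_of_split`, Neukirch VII (6.9)).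
[cite: NeukirchANT1999, Ch. VII §6 Prop. (6.9)] -/
theorem not_isUnramifiedAt_mul_compRelNorm_ofDirichlet_of_split [IsGalois ℚ K]
    (h2 : Module.finrank ℚ K = 2) (hsplit : ((Ideal.span {(p : ℤ)}).primesOver (𝓞 K)).ncard = 2)
    {m : ℕ} [NeZero m] {θ : DirichletCharacter ℂ m} (hθ : θ.IsPrimitive) (hpm : p ∣ m)
    {χ₀ : HeckeCharacter K} (𝔮 : HeightOneSpectrum (𝓞 K)) (h𝔮 : ((p : ℕ) : 𝓞 K) ∈ 𝔮.asIdeal)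
    (hχ₀ : χ₀.IsUnramifiedAt 𝔮) :
    ¬ (χ₀ * (HeckeCharacter.ofDirichlet θ).compRelNorm K).IsUnramifiedAt 𝔮 := by
  have h := hasConductorExponentAt_mul_compRelNorm_ofDirichlet_of_split K p h2 hsplit hθ 𝔮 h𝔮 hχ₀
  exact h.pos_iff_not_isUnramifiedAt.mp (Nat.Prime.factorization_pos_of_dvd hp.out (NeZero.ne m) hpm)

/-- ★★ **The road-(C) pair character is NOT EXCEPTIONAL above `p ∣ cond θ`.** For a quadratic field
`K` in which `p` splits, `𝔮 ∋ p`, a Hecke character `χ₀` of `K` unramified at `𝔮`, a PRIMITIVE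
Dirichlet character `θ` mod `m` with `p ∣ m`, and any unit-root datum `a ≠ 0`:
`IsNotExceptionalAt a (χ₀ · (ψ_θ ∘ N_{K/ℚ})) 𝔮`. At `p = 2`, `K = ℚ(√−7)`, `θ = ε_{d*}` (conductor `4`
or `8`) and `χ₀` the part of the pair character unramified above `2`, this is the hypothesis «`χ` not
exceptional» of Disegni's Theorem B at both places above `2`, for all three classes `d* ∈ {−1, ±2}` at
once (cell `bsd-print-cf2`, entry ticket §2: «`χ_w` RAMIFIED ⇒ Gauss-sum branch ⇒ `Z_w ≠ 0`»).
[cite: Disegni2017, Def. 1.3.3 (arXiv v3 PDF p. 7 L50), Theorem B hypotheses (PDF p. 8 L9–17), Lemma A.1.1 (PDF p. 70)]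
[cite: NeukirchANT1999, Ch. VII §6 Prop. (6.9)] -/
theorem isNotExceptionalAt_mul_compRelNorm_ofDirichlet_of_split [IsGalois ℚ K]
    (h2 : Module.finrank ℚ K = 2) (hsplit : ((Ideal.span {(p : ℤ)}).primesOver (𝓞 K)).ncard = 2)
    {m : ℕ} [NeZero m] {θ : DirichletCharacter ℂ m} (hθ : θ.IsPrimitive) (hpm : p ∣ m)
    {χ₀ : HeckeCharacter K} (𝔮 : HeightOneSpectrum (𝓞 K)) (h𝔮 : ((p : ℕ) : 𝓞 K) ∈ 𝔮.asIdeal)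
    (hχ₀ : χ₀.IsUnramifiedAt 𝔮) {a : ℂ} (ha : a ≠ 0) :
    IsNotExceptionalAt (p := p) a (χ₀ * (HeckeCharacter.ofDirichlet θ).compRelNorm K) 𝔮 :=
  isNotExceptionalAt_of_not_isUnramifiedAt_of_split h2 hsplit ha _ 𝔮 h𝔮
    (not_isUnramifiedAt_mul_compRelNorm_ofDirichlet_of_split h2 hsplit hθ hpm 𝔮 h𝔮 hχ₀)

/-- The same for the bare base change `ψ_θ ∘ N_{K/ℚ}` (`χ₀ = 1`): the genus-type character of a
primitive `θ` with `p ∣ cond θ` is not exceptional above a split `p`.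
[cite: Disegni2017, Def. 1.3.3 (arXiv v3 PDF p. 7 L50), Lemma A.1.1 (PDF p. 70)]
[cite: NeukirchANT1999, Ch. VII §6 Prop. (6.9)] -/
theorem isNotExceptionalAt_compRelNorm_ofDirichlet_of_split [IsGalois ℚ K]
    (h2 : Module.finrank ℚ K = 2) (hsplit : ((Ideal.span {(p : ℤ)}).primesOver (𝓞 K)).ncard = 2)
    {m : ℕ} [NeZero m] {θ : DirichletCharacter ℂ m} (hθ : θ.IsPrimitive) (hpm : p ∣ m)
    (𝔮 : HeightOneSpectrum (𝓞 K)) (h𝔮 : ((p : ℕ) : 𝓞 K) ∈ 𝔮.asIdeal) {a : ℂ} (ha : a ≠ 0) :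
    IsNotExceptionalAt (p := p) a ((HeckeCharacter.ofDirichlet θ).compRelNorm K) 𝔮 := by
  have h := isNotExceptionalAt_mul_compRelNorm_ofDirichlet_of_split (χ₀ := 1) h2 hsplit hθ hpm 𝔮 h𝔮
    (fun _ => by rw [HeckeCharacter.localComponent_apply, HeckeCharacter.one_apply]) ha
  rwa [one_mul] at h

end Literature.NumberTheory.EllipticCurves.Disegni2017

end
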